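import Mathlib.Algebra.Category.ModuleCat.Differentials.Presheaf
import Mathlib.Algebra.Category.ModuleCat.Presheaf.Sheafification
import Mathlib.Algebra.Category.ModuleCat.Sheaf.LocallyFree
import Mathlib.AlgebraicGeometry.Modules.Sheaf
import Mathlib.AlgebraicGeometry.Morphisms.Smooth
import Mathlib.AlgebraicGeometry.Noetherian
import Mathlib.CategoryTheory.Sites.SheafCohomology.Basic
import Mathlib.CategoryTheory.Abelian.GrothendieckAxioms.Sheaf
import Mathlib.CategoryTheory.Abelian.GrothendieckCategory.HasExt
import Mathlib.Topology.KrullDimension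
import Mathlib.Topology.Sheaves.Abelian
import Mathlib.Algebra.Category.Grp.AB
import HarnessLib

-- provenance: harness21/H21/H21/Prelude/MotiveL/Differentials.lean @ 95ee30e (interim HEAD d8f2665); M5 mechanical rewrite
/-!
# The sheaf of Kähler differentials `Ω¹_{X/k}` of a `k`-scheme and its cohomology

Trunk: MotiveL (G23), prelude item `Differentials` (honest anchor for the notions
`algebraic_de_rham_cohomology`, `coherent_sheaf_gaga`).

For a commutative ring `k` and a `k`-scheme `X : Over (Spec (.of k))` we construct, honestly and
with Mathlib's sheaf-of-modules API,

* `constToPresheaf X`: the structure morphism `k → Γ(X, U)` as a morphism of presheaves of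
  commutative rings from the constant presheaf;
* `kaehlerPresheaf X`: the presheaf of modules `U ↦ Ω_{Γ(X,U)/k}`
  (Mathlib's `PresheafOfModules.DifferentialsConstruction.relativeDifferentials'`) together with its
  universal derivation `kaehlerPresheaf.d X` (Mathlib's `derivation'`);
* `cotangentSheaf X : X.left.Modules`: the sheaf `Ω¹_{X/k}`, the sheafification of `kaehlerPresheaf X`
  (Mathlib's `PresheafOfModules.sheafification`), and the canonical map `toCotangentSheaf X` from the
  presheaf to (the underlying presheaf of) its sheafification;
* `hodgeCohomologyOne X q = H^q(X, Ω¹_{X/k})` and `structureSheafCohomology X q = H^q(X, 𝒪_X)`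
  (Mathlib's `Sheaf.H`, i.e. `Ext` from the constant sheaf `ℤ`; these live in `Type u` thanks to the
  instance `IsGrothendieckAbelian.hasExt` for sheaves of abelian groups on a small site).

Theorems (proofs deferred): `Ω¹_{X/k}` is locally free when `X → Spec k` is smooth of some relative
dimension (Hartshorne II.8.15 / EGA IV 17.2.3), its sections over an affine open `U` are the module of
Kähler differentials `Ω_{Γ(X,U)/k}` (Hartshorne II.8.9.2), and Grothendieck vanishing
`H^q(X, Ω¹) = 0` for `q > dim X` on a noetherian scheme (Hartshorne III.2.7).

Sources: R. Hartshorne, *Algebraic Geometry* (1977), II.8 and III.2; EGA IV (1967), §16.3, §17.2.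

Design choices.
* We work with `X : Over (Spec (CommRingCat.of k))`, which is definitionally G17's `SchemeOver k`, so
  this file needs no H21 import.
* `H^q(X, 𝒪_X)` is defined through the free rank-one sheaf of modules `SheafOfModules.unit` and the
  forgetful functor `SheafOfModules.toSheaf` (there is no `forget₂ CommRingCat AddCommGrpCat`).
* The comparison with `Ω_{Γ(X,U)/k}` on affine opens is stated as bijectivity of the component at `U`
  of the sheafification unit `toCotangentSheaf X`, whose source is literally
  `CommRingCat.KaehlerDifferential ((constToPresheaf X).app (op U))`; this avoids transporting module
  structures between `RingCat`- and `CommRingCat`-valued section rings.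
* Functoriality `cotangentSheaf_map` for morphisms over `k` is omitted in v0 (it needs the pullback of
  sheaves of modules composed with the universal property of `relativeDifferentials'`; not cheap).
-/

open CategoryTheory AlgebraicGeometry Opposite TopologicalSpace

universe u

namespace Literature.AlgebraicGeometry.Motives

section

variable {k : Type u} [CommRing k] (X : Over (Spec (CommRingCat.of k)))

/-- The structure morphism on sections, `k → Γ(X, U)` for every open `U ⊆ X`, packaged as a morphism
of presheaves of commutative rings from the constant presheaf with value `k` to the structure presheaf
of `X`. On `U` it is `k ≅ Γ(Spec k) → Γ(X, X) → Γ(X, U)`.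
(Hartshorne, *Algebraic Geometry*, II.8, the `k`-algebra structure on `𝒪_X`.) [folklore] -/
noncomputable def constToPresheaf :
    (Functor.const (Opens X.left)ᵒᵖ).obj (CommRingCat.of k) ⟶ X.left.presheaf where
  app U := (Scheme.ΓSpecIso (CommRingCat.of k)).inv ≫ X.hom.appTop ≫
    X.left.presheaf.map (homOfLE le_top).op
  naturality U V i := by
    simp only [Functor.const_obj_map, Category.assoc]
    rw [← Functor.map_comp]
    rfl

/-- The presheaf of modules of relative Kähler differentials `U ↦ Ω_{Γ(X,U)/k}` over the structure
presheaf of the `k`-scheme `X`; its sheafification is `Ω¹_{X/k}` (`cotangentSheaf`).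
(Hartshorne, *Algebraic Geometry*, II.8, p. 175; EGA IV 16.3.1.) [folklore] -/
noncomputable def kaehlerPresheaf : X.left.PresheafOfModules :=
  PresheafOfModules.DifferentialsConstruction.relativeDifferentials' (constToPresheaf X)

/-- The universal `k`-linear derivation `d : 𝒪_X → Ω_{𝒪_X/k}` into the presheaf of Kähler
differentials, i.e. Mathlib's `DifferentialsConstruction.derivation'`.
(Hartshorne, *Algebraic Geometry*, II.8, p. 172–175; EGA IV 16.3.5.) [folklore] -/
noncomputable def kaehlerPresheaf.d : (kaehlerPresheaf X).Derivation' (constToPresheaf X) :=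
  PresheafOfModules.DifferentialsConstruction.derivation' (constToPresheaf X)

/-- The cotangent sheaf (sheaf of Kähler differentials) `Ω¹_{X/k}` of the `k`-scheme `X`, as an
`𝒪_X`-module: the sheafification of the presheaf `U ↦ Ω_{Γ(X,U)/k}`.
(Hartshorne, *Algebraic Geometry*, II.8, Remark 8.9.2; EGA IV 16.3.1.) [folklore] -/
noncomputable def cotangentSheaf : X.left.Modules :=
  (PresheafOfModules.sheafification (𝟙 X.left.ringCatSheaf.obj)).obj (kaehlerPresheaf X)

/-- The canonical morphism of presheaves of modules from `U ↦ Ω_{Γ(X,U)/k}` to (the underlying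
presheaf of) its sheafification `Ω¹_{X/k}`: the unit of the sheafification adjunction.
(Hartshorne, *Algebraic Geometry*, II.1.2 and II.8.9.2.) [folklore] -/
noncomputable def toCotangentSheaf :
    kaehlerPresheaf X ⟶ (PresheafOfModules.restrictScalars (𝟙 X.left.ringCatSheaf.obj)).obj
      (cotangentSheaf X).val :=
  (PresheafOfModules.sheafificationAdjunction (𝟙 X.left.ringCatSheaf.obj)).unit.app
    (kaehlerPresheaf X)

/-- The Hodge cohomology group `H^q(X, Ω¹_{X/k})`, defined as sheaf cohomology (`Sheaf.H`, an `Ext`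
group from the constant sheaf `ℤ`) of the underlying abelian sheaf of `Ω¹_{X/k}`.
(Hartshorne, *Algebraic Geometry*, III.2 and III.7; Deligne–Illusie 1987, §2.) [cite: DeligneIllusie1987, §2] -/
noncomputable def hodgeCohomologyOne (q : ℕ) : Type u :=
  ((SheafOfModules.toSheaf X.left.ringCatSheaf).obj (cotangentSheaf X)).H q

end

/-- The coherent cohomology group `H^q(X, 𝒪_X)` of the structure sheaf of a scheme `X`, defined as
sheaf cohomology (`Sheaf.H`) of the abelian sheaf underlying the free rank-one `𝒪_X`-module
`SheafOfModules.unit`.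
(Hartshorne, *Algebraic Geometry*, III.2.) [folklore] -/
noncomputable def structureSheafCohomology (X : Scheme.{u}) (q : ℕ) : Type u :=
  ((SheafOfModules.toSheaf X.ringCatSheaf).obj (SheafOfModules.unit X.ringCatSheaf)).H q

section

variable {k : Type u} [CommRing k] (X : Over (Spec (CommRingCat.of k)))

/-- `H^q(X, Ω¹_{X/k})` is an abelian group (it is an `Ext` group). [folklore] -/
noncomputable instance (q : ℕ) : AddCommGroup (hodgeCohomologyOne X q) :=
  inferInstanceAs (AddCommGroup (Abelian.Ext _ _ q))

/-- `H^q(X, 𝒪_X)` is an abelian group (it is an `Ext` group). [folklore] -/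
noncomputable instance (Y : Scheme.{u}) (q : ℕ) : AddCommGroup (structureSheafCohomology Y q) :=
  inferInstanceAs (AddCommGroup (Abelian.Ext _ _ q))

/-- If `X → Spec k` is smooth of relative dimension `n`, then `Ω¹_{X/k}` is a locally free
`𝒪_X`-module (of rank `n`).
(Hartshorne, *Algebraic Geometry*, II.8.15 and III.10.0.2; EGA IV 17.2.3(i)⇒(ii).) [cite: StacksProject, Tag 02G1] [cite: Hartshorne1977, II.8.15 (the case of a variety over an algebraically closed field)] -/
def isLocallyFree_cotangentSheaf : Prop :=
  ∀ (n : ℕ) [SmoothOfRelativeDimension n X.hom],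
    SheafOfModules.IsLocallyFree (R := X.left.ringCatSheaf) (cotangentSheaf X)

/-- On an affine open `U ⊆ X` the sections of `Ω¹_{X/k}` are the Kähler differentials of the ring of
sections: the canonical map `Ω_{Γ(X,U)/k} → Γ(U, Ω¹_{X/k})` is bijective.
(Hartshorne, *Algebraic Geometry*, II.8.9.2: `Ω_{X/Y}|_U ≅ (Ω_{B/A})~` for `U = Spec B`.) [cite: Hartshorne1977, II.8.9.2] -/
def bijective_toCotangentSheaf_app : Prop :=
  ∀ {U : X.left.Opens} (hU : IsAffineOpen U),
    Function.Bijective ((toCotangentSheaf X).app (op U))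

/-- On an affine open `U ⊆ X`, `Γ(U, Ω¹_{X/k}) ≅ Ω_{Γ(X,U)/k}` as abelian groups
(a restatement of `bijective_toCotangentSheaf_app`).
(Hartshorne, *Algebraic Geometry*, II.8.9.2.) [cite: Hartshorne1977, II.8.9.2] -/
def nonempty_sections_cotangentSheaf_iso : Prop :=
  ∀ {U : X.left.Opens} (hU : IsAffineOpen U),
    Nonempty (((cotangentSheaf X).val.obj (op U) : Type u) ≃+
      CommRingCat.KaehlerDifferential ((constToPresheaf X).app (op U)))

/-- **Grothendieck vanishing** for `Ω¹`: on a noetherian `k`-scheme `X` of (topological Krull)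
dimension `< q`, the Hodge cohomology group `H^q(X, Ω¹_{X/k})` vanishes.
(Hartshorne, *Algebraic Geometry*, III.2.7; Grothendieck, Tôhoku 1957, 3.6.5.) [cite: Tohoku1957, 3.6.5] -/
def subsingleton_hodgeCohomologyOne_of_lt : Prop :=
  ∀ [IsNoetherian X.left] (q : ℕ) (hq : topologicalKrullDim X.left < q),
    Subsingleton (hodgeCohomologyOne X q)

/-- **Grothendieck vanishing** for `𝒪_X`: on a noetherian scheme `X` of (topological Krull)
dimension `< q`, `H^q(X, 𝒪_X)` vanishes.
(Hartshorne, *Algebraic Geometry*, III.2.7.) [cite: Hartshorne1977, III.2.7] -/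
def subsingleton_structureSheafCohomology_of_lt : Prop :=
  ∀ (Y : Scheme.{u}) [IsNoetherian Y] (q : ℕ) (hq : topologicalKrullDim Y < q),
    Subsingleton (structureSheafCohomology Y q)

end

end Literature.AlgebraicGeometry.Motives
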